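import Mathlib
import Literature.Analysis.Calculus.NewtonKantorovichHolds
import Summits.NavierStokesRegularity.NavierStokesRegularity.Theorems.FilamentSkeletonRssSkeletonJ1RKantorovichLinearStep

/-!
# Crux `SkeletonJ1R` (stmt-NavierStokesRegularity-23610) · registered line `streamline_kantorovich_R` · stub K-B′ `KantorovichClosingBL1` —
# THE ABSTRACT CLOSING: Newton–Kantorovich for a FIXED-POINT problem `X = Φ(X)` whose linearisation `DΦ(x₀)` is COMPACT and whose
# linearised defect `I − DΦ(x₀)` obeys an A-PRIORI BOUND `‖v‖ ≤ K‖v − DΦ(x₀)v‖` (the shape in which F1/F2-B/F2-d/L′ feed K-B′)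

Hand `leafhand-ns-filamentskeletonrs-1` g2 (prover), 2026-08-31, `--supports stmt-NavierStokesRegularity-23610 --as helper`; pure Mathlib +
`Literature.Analysis.Calculus.NewtonKantorovichHolds` (Deuflhard's affine covariant theorem, PROVED in the tree) + the landed linear step
`…SkeletonJ1RKantorovichLinearStep` (p819347).  Route-independent.  MODEL rung, NEGATIVE side of the NS ladder: the use is in a line about a
HYPOTHETICAL filament-type blow-up skeleton; nothing here bears on Navier–Stokes regularity, which is NOT proved.

WHY (K-notes §1–§2, §4(d) of the lead: "norm bookkeeping + `NewtonKantorovich_holds` instantiation: M").  Stub K-B′ builds the streamline map `Φ¹` on a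
ball about the LIA reference `x` in a Banach space `E` of weighted `C¹` normal fields and applies Newton–Kantorovich to `G := I − Φ¹`.  Its four
inputs are numbers: the DEFECT `η ≥ ‖x − Φ¹(x)‖_E` (F2-B/F2-d: `η ≍ C_d ℓ/√log Γ`), the A-PRIORI CONSTANT `K` of L′ (`‖Y‖ ≤ K‖(I − DΦ¹(x))Y‖`,
Γ-uniform), the LIPSCHITZ constant `ω₁` of `DΦ¹` on the ball (second variation, `≍ 1/ℓ`), and the ball RADIUS `R` on which `Φ¹` is a `C¹` chart
(regular-waist / tube margins).  THIS FILE is the theorem those numbers are aimed at: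

* `rhoMinus_le_two_mul` — Deuflhard's existence radius `ρ₋ = (1 − √(1 − 2h₀))/ω̄₀ ≤ 2α` (`0 ≤ α`, `0 < ω̄₀`, `h₀ = αω̄₀ ≤ ½`);
* ★ `exists_fixedPoint_of_apriori_bound` — `E` real Banach, `Φ : E → E` with Fréchet derivative `Φ' y` at every `y ∈ S(x₀, R)`, `Φ'` `ω₁`-Lipschitz
  on `S(x₀, R)` (operator norm), `Φ' x₀` COMPACT, `‖v‖ ≤ K‖v − Φ' x₀ v‖` for all `v` (`0 < K`, `0 < ω₁`), `‖x₀ − Φ x₀‖ ≤ η`, and the Kantorovich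
  smallness `(Kη)(Kω₁) ≤ ½` with room `2Kη < R` ⟹ there is `x⋆` with `Φ x⋆ = x⋆` and `‖x⋆ − x₀‖ ≤ 2Kη`.
  (Data for `KantorovichData`: `F := I − Φ`, `F' := 1 − Φ'`, `D := S(x₀, R)`, `G := (1 − Φ' x₀)⁻¹` from the linear step
  `KantorovichLinearStep.exists_equiv_of_apriori_bound` with `J := 1` (so `‖G‖ ≤ K`), `α := Kη`, `ω̄₀ := Kω₁`.)

In the line: `h = (Kη)(Kω₁) ≍ K²·C_d ℓ/√log Γ · 1/ℓ = K² C_d/√log Γ → 0` and `2Kη ≍ Rb³√Γ ≪ R ≍ Rb√Γ` — the two displayed hypotheses are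
exactly the card's "first Newton step inside the fine tolerance" and "`h → 0`".  [Deuflhard 2011 Thm 2.1; Kantorovich 1948] [folklore]
-/

set_option linter.dupNamespace false -- `NavierStokesRegularity.NavierStokesRegularity` path/namespace repetition is the tree convention

noncomputable section

namespace Summit.NavierStokesRegularity.NavierStokesRegularity.Theorems.SkeletonJ1RFrame.KantorovichFixedPoint

open Metric Set Filter Function Literature.Analysis.Calculus
open Summit.NavierStokesRegularity.NavierStokesRegularity.Theorems.SkeletonJ1RFrame.KantorovichLinearStep
open scoped Topology

/-- Deuflhard's existence radius is at most twice the first Newton step: `(1 − √(1 − 2αω))/ω ≤ 2α` for `0 ≤ α`, `0 < ω`, `αω ≤ ½`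
(`√t ≥ t` on `[0, 1]` with `t = 1 − 2αω`). [folklore] -/
theorem rhoMinus_le_two_mul {α ω : ℝ} (hα : 0 ≤ α) (hω : 0 < ω) (hh : α * ω ≤ 1 / 2) :
    (1 - Real.sqrt (1 - 2 * (α * ω))) / ω ≤ 2 * α := by
  rw [div_le_iff₀ hω]
  have ht0 : 0 ≤ 1 - 2 * (α * ω) := by linarith
  have ht1 : 1 - 2 * (α * ω) ≤ 1 := by nlinarith
  have hsq : 1 - 2 * (α * ω) ≤ Real.sqrt (1 - 2 * (α * ω)) := by
    conv_lhs => rw [← Real.sqrt_sq ht0]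
    apply Real.sqrt_le_sqrt
    nlinarith
  nlinarith

variable {E : Type*} [NormedAddCommGroup E] [NormedSpace ℝ E] [CompleteSpace E]

/-- ★ **Newton–Kantorovich, fixed-point form with compact linearisation and an a-priori injectivity bound.**  Let `Φ : E → E` (`E` real Banach)
have Fréchet derivative `Φ' y` at every `y` of the open ball `S(x₀, R)`, with `‖Φ' y − Φ' z‖ ≤ ω₁‖y − z‖` there, `Φ' x₀` compact, and the a-priori
bound `‖v‖ ≤ K ‖v − Φ' x₀ v‖` for all `v` (`0 < K`, `0 < ω₁`).  If `‖x₀ − Φ x₀‖ ≤ η`, `(Kη)(Kω₁) ≤ ½` and `2Kη < R`, then `Φ` has a fixed point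
`x⋆` with `‖x⋆ − x₀‖ ≤ 2Kη`.  (Deuflhard's theorem for `F = I − Φ` with `G = (1 − Φ' x₀)⁻¹`, `‖G‖ ≤ K` by the Fredholm-alternative linear step,
`α = Kη`, `ω̄₀ = Kω₁`, `ρ₋ ≤ 2α < R`.) [folklore] -/
theorem exists_fixedPoint_of_apriori_bound (Φ : E → E) (Φ' : E → E →L[ℝ] E) (x₀ : E) {R K ω₁ η : ℝ}
    (hK : 0 < K) (hω₁ : 0 < ω₁) (hη : 0 ≤ η)
    (hderiv : ∀ y ∈ ball x₀ R, HasFDerivAt Φ (Φ' y) y)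
    (hlip : ∀ y ∈ ball x₀ R, ∀ z ∈ ball x₀ R, ‖Φ' y - Φ' z‖ ≤ ω₁ * ‖y - z‖)
    (hcpt : IsCompactOperator (Φ' x₀))
    (hapriori : ∀ v, ‖v‖ ≤ K * ‖v - Φ' x₀ v‖)
    (hdefect : ‖x₀ - Φ x₀‖ ≤ η)
    (hsmall : (K * η) * (K * ω₁) ≤ 1 / 2) (hroom : 2 * (K * η) < R) :
    ∃ xstar : E, Φ xstar = xstar ∧ ‖xstar - x₀‖ ≤ 2 * (K * η) := by
  -- the linear step: `1 − Φ' x₀` is an isomorphism with inverse bound `K`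
  set S : E →L[ℝ] E := 1 - Φ' x₀ with hS
  have hSJ : IsCompactOperator (S - ((ContinuousLinearEquiv.refl ℝ E : E ≃L[ℝ] E) : E →L[ℝ] E) : E →L[ℝ] E) := by
    have h1 : (S - ((ContinuousLinearEquiv.refl ℝ E : E ≃L[ℝ] E) : E →L[ℝ] E) : E →L[ℝ] E) = -Φ' x₀ := by
      ext v; simp [hS]
    rw [h1]; exact hcpt.neg
  have hSap : ∀ v, ‖v‖ ≤ K * ‖S v‖ := fun v => by simpa [hS] using hapriori v
  obtain ⟨T, hT, hTn⟩ := exists_equiv_of_apriori_bound S (ContinuousLinearEquiv.refl ℝ E) hSJ hK.le hSap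
  have hR : 0 < R := by nlinarith
  -- the Kantorovich data
  let d : KantorovichData E E :=
    { F := fun y => y - Φ y
      F' := fun y => 1 - Φ' y
      D := ball x₀ R
      x0 := x₀
      G := (T.symm : E →L[ℝ] E)
      α := K * η
      ω := K * ω₁
      isOpen_D := isOpen_ball
      convex_D := convex_ball x₀ R
      x0_mem := mem_ball_self hR
      hasFDerivAt := fun y hy => (hasFDerivAt_id y).sub (hderiv y hy)
      continuousOn_F' := by
        have hΦ'c : ContinuousOn Φ' (ball x₀ R) := by
          have hL : LipschitzOnWith (Real.toNNReal ω₁) Φ' (ball x₀ R) :=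
            LipschitzOnWith.of_dist_le_mul fun y hy z hz => by
              rw [dist_eq_norm, dist_eq_norm, Real.coe_toNNReal _ hω₁.le]; exact hlip y hy z hz
          exact hL.continuousOn
        exact continuousOn_const.sub hΦ'c
      G_left := fun v => by
        have : (1 - Φ' x₀) v = T v := by rw [hT v]
        rw [this]; exact T.symm_apply_apply v
      G_right := fun w => by
        show (1 - Φ' x₀) (T.symm w) = w
        rw [← hT (T.symm w)]; exact T.apply_symm_apply w
      norm_G_F_le := by
        calc ‖(T.symm : E →L[ℝ] E) (x₀ - Φ x₀)‖ ≤ ‖(T.symm : E →L[ℝ] E)‖ * ‖x₀ - Φ x₀‖ := ContinuousLinearMap.le_opNorm _ _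
          _ ≤ K * η := mul_le_mul hTn hdefect (norm_nonneg _) hK.le
      lipschitz := fun y hy z hz => by
        calc ‖(T.symm : E →L[ℝ] E).comp ((1 - Φ' z) - (1 - Φ' y))‖
            ≤ ‖(T.symm : E →L[ℝ] E)‖ * ‖(1 - Φ' z) - (1 - Φ' y)‖ := ContinuousLinearMap.opNorm_comp_le _ _
          _ = ‖(T.symm : E →L[ℝ] E)‖ * ‖Φ' y - Φ' z‖ := by
              congr 1; rw [show (1 - Φ' z) - (1 - Φ' y) = Φ' y - Φ' z by abel]
          _ ≤ K * (ω₁ * ‖y - z‖) := mul_le_mul hTn (hlip y hy z hz) (norm_nonneg _) hK.le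
          _ = K * ω₁ * ‖z - y‖ := by rw [norm_sub_rev]; ring
      ω_pos := mul_pos hK hω₁
      h0_le := hsmall }
  -- the existence radius fits in the chart ball
  have hρ : d.rhoMinus ≤ 2 * (K * η) :=
    rhoMinus_le_two_mul (by positivity) (mul_pos hK hω₁) hsmall
  have hball : closedBall d.x0 d.rhoMinus ⊆ d.D := closedBall_subset_ball (lt_of_le_of_lt hρ hroom)
  obtain ⟨_, _, _, xstar, hxmem, hzero, _⟩ := d.newtonKantorovich hball
  refine ⟨xstar, ?_, ?_⟩
  · have h0 : xstar - Φ xstar = 0 := hzero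
    exact (sub_eq_zero.mp h0).symm
  · have h1 : dist xstar x₀ ≤ d.rhoMinus := mem_closedBall.mp hxmem
    rw [dist_eq_norm] at h1
    exact h1.trans hρ

end Summit.NavierStokesRegularity.NavierStokesRegularity.Theorems.SkeletonJ1RFrame.KantorovichFixedPoint

end
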